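import Literature.RepresentationTheory.BorelWallach2000.U11PrimaryDecomposition
import Literature.NumberTheory.Automorphic.GKModulesPrimary
import HarnessLib

/-!
# The Casimir element of `Z(𝔤)` for `U(α, β)` and the centre element `Z ∈ Z(𝔤)` for `U(1,1)`:
# Knapp–Vogan's `Z(𝔤)`-notions (§VII.2) imply the lineage's `(Z, C)`-notions

Family `hodge`, lane `lit-hodgefound` (foundations library; seat `lit-hodgefound-p39`, generation 22, row g22-#4); topic
`RepresentationTheory/BorelWallach2000`; namespace `Literature.RepresentationTheory.BorelWallach2000` (three general-`G` lemmas are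
placed in `Literature.NumberTheory.Automorphic` next to `GKModulesPrimary`).  The BRIDGE between the general-`G` file
`Literature.NumberTheory.Automorphic.GKModulesPrimary` (Knapp–Vogan (7.13), `P_θ(V)`, (7.26a) for `Z(𝔤) = centerU G`) and the
`U(1,1)` files `U11HarishChandraModules` / `U11PrimaryDecomposition` (which render `Z(𝔤𝔩₂(ℂ)) = ℂ[Z, C̃]` by the two
operators `ρ𝔤(Z)`, `C`): the Casimir ELEMENT `c ∈ Z(𝔤)` of `U(α, β)` (the tree's `casimirElement` of the trace form, central
by `casimirElement_mem_center`) acts by the Casimir OPERATOR `upqCasimirOp`, and `Z = i·1 ∈ 𝔤` is central in `U(𝔤)`; hence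
`Z(𝔤)` finite ⟹ `(Z, C)`-finite, a (generalized) infinitesimal character `θ` of `Z(𝔤)` gives the lineage's `(θ(Z), θ(c))`,
and `P_θ(V) ⊆ P_{(θ(Z), θ(c))}(V)`.  TWO `def`s with bodies (`upqCasimirCenter`, `u11ZCenter` — elements of `centerU`),
theorems otherwise; 0 `sorry`, 0 new axioms, no named fact (net debt 0, D-0026).  The converse implications need
`Z(𝔤𝔩₂) = ℂ[Z, C̃]` (Harish-Chandra isomorphism), which the tree does not have; they are not claimed.

## Sources

A. W. Knapp, D. A. Vogan, *Cohomological Induction and Unitary Representations* (1995) [KnappVogan1995], §VII.2 (7.13) («EXAMPLES.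
1) If `V` has infinitesimal character `λ` … `V` is `Z(𝔤)` finite»), Prop. 7.20, (7.25), (7.26a), Cor. 7.27; §IV.9 (the Casimir
element lies in `Z(𝔤)`).  A. Borel, N. Wallach (2000) [BorelWallach2000], II §1.3 (1): «`C = Σ y_s y'_s` … the Casimir element …
lies in the center of `U(𝔤)`».  D. Bump (1997) [Bump1997], §2.2 (2.21) (`Z = i·1` spans the centre of `𝔤𝔩₂`), Prop. 2.5.2.

## What is formalised

* §1 (any `G`): `IsCenterFinite.exists_aeval_centerAction_eq_zero` (on `Z(𝔤)` finite data every `z` acts algebraically),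
  `HasInfinitesimalCharacter.centerAction_eq_smul_one`, `primaryComponent_le_maxGenEigenspace`, `HasGenInfinitesimalCharacter.unique`.
* §2 (`U(α, β)`): **`upqCasimirCenter α β : centerU (uFormGroup α β)`** (`coe_upqCasimirCenter : c = Σ_t ι(y_t) ι(y'_t)`),
  **`centerAction_upqCasimirCenter : ρ(c) = upqCasimirOp ρ𝔤`**, `upqCasimirOp_eq_smul_one_of_hasInfinitesimalCharacter`
  (`C_V = θ(c)`), `exists_aeval_upqCasimirOp_eq_zero_of_isCenterFinite`, `exists_pow_upqCasimirOp_sub_eq_zero_of_hasGenInfinitesimalCharacter`,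
  `primaryComponent_le_maxGenEigenspace_upqCasimirOp`.
* §3 (`U(1,1)`): **`u11ZCenter : centerU G11`** (`ι(Z)`), `centerAction_u11ZCenter : ρ(Z) = ρ𝔤(Z)`,
  **`isZCFinite_of_isCenterFinite`**, **`u11HasGenInfChar_of_hasGenInfinitesimalCharacter`**, `u11_scalars_of_hasInfinitesimalCharacter`,
  **`primaryComponent_le_inf_maxGenEigenspace` / `primaryComponent_le_primary`** (`P_θ ⊆ P_{(θ(Z), θ(c))}`), and for
  `GKRing G11`-modules `exists_int_of_primaryComponent_ne_bot` (`P_θ(M) ≠ 0 ⟹ θ(Z) ∈ iℤ`) and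
  `exists_mem_testSet_of_primaryComponent_ne_bot` (then a `K`-type from the finite test set occurs).

Consumed by name: `casimirElement`, `casimirElement_mem_center`, `mem_center_of_forall_ι_comm` (`Literature.Algebra.Lie.CasimirElement`);
`upqTraceForm_nondegenerate/_isSymm/_lieInvariant`, `upqBasis`, `coe_upqBasis`, `upqDualBasis`, `coe_upqDualBasis`, `upqY`, `upqY'`,
`upqCasimirOp` (`UpqCasimirTensor`); `centerAction(_apply)`, `IsCenterFinite`, `primaryComponent`, `iSupIndep_primaryComponent`,
`HasGenInfinitesimalCharacter(.primaryComponent_eq_top)` (`GKModulesPrimary`); `HasInfinitesimalCharacter`, `envelopingAction_ι`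
(`GKModules`); `U11FinRep.zCenter`, `lie_zCenter`; `U11HC.IsZCFinite`, `testSet`; `U11Primary.HasGenInfChar`, `primary`,
`restrictScalars_primary`, `exists_int_of_primary_ne_bot`, `exists_mem_testSet_of_primary_ne_bot` (`U11PrimaryDecomposition`).

## References

* A. W. Knapp, D. A. Vogan, *Cohomological Induction and Unitary Representations*, Princeton Math. Ser. 45 (1995), §IV.9, §VII.2
  (7.13), Prop. 7.20, (7.25), (7.26a), Cor. 7.27, Cor. 7.207. [KnappVogan1995]
* A. Borel, N. Wallach, *Continuous Cohomology, Discrete Subgroups, and Representations of Reductive Groups*, 2nd ed. (2000),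
  II §1.3 (1). [BorelWallach2000]
* D. Bump, *Automorphic Forms and Representations* (1997), §2.2 (2.21), Prop. 2.5.2. [Bump1997]
-/


noncomputable section

open scoped Matrix ComplexConjugate
open Polynomial Module Module.End UniversalEnvelopingAlgebra

namespace Literature.RepresentationTheory.BorelWallach2000

open Literature.Algebra.Lie Literature.Algebra.Lie.ChevalleyEilenberg
open Literature.NumberTheory.Automorphic
open Literature.RepresentationTheory.KonnoKonno2007 Literature.RepresentationTheory.KonnoKonno2007.RealDualPair
open Literature.RepresentationTheory.KonnoKonno2007.RealDualPair.UForm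
open Literature.LinearAlgebra
open U11HolDS

-- Mathlib idiom (as in `GKModules`, `GKCohomology`): commutator bracket on `Module.End` / matrices
attribute [local instance 100] LieRing.ofAssociativeRing

-- carriers `↥W` over `GKRing G11` with their `ℂ`-structures (as in `GKModuleRing` §7–§8)
set_option maxSynthPendingDepth 4

/-! ## §1 Any group: algebraic `Z(𝔤)`-operators on `Z(𝔤)` finite data -/

section AnyGroup

variable {A : Type*} [NormedCommRing A] [NormedAlgebra ℝ A] [NormedAlgebra ℚ A] [CompleteSpace A]
  [StarRing A] {N : Type*} [Fintype N] [DecidableEq N] {G : RealMatrixGroup A N}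
  {V : Type*} [AddCommGroup V] [Module ℂ V] (ρ𝔤 : G.lie →ₗ⁅ℝ⁆ Module.End ℂ V)

/-- **On `Z(𝔤)` finite data every `z ∈ Z(𝔤)` acts algebraically**: some non-zero polynomial in `ρ(z)` vanishes (the element of the
finite-dimensional image algebra is integral over `ℂ`). [cite: KnappVogan1995, §VII.2 (7.13), Prop. 7.20 (proof)] -/
theorem _root_.Literature.NumberTheory.Automorphic.IsCenterFinite.exists_aeval_centerAction_eq_zero (h : IsCenterFinite ρ𝔤)
    (z : centerU G) :
    ∃ p : ℂ[X], p ≠ 0 ∧ aeval (centerAction ρ𝔤 z) p = 0 := by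
  haveI : FiniteDimensional ℂ (Algebra.adjoin ℂ (Set.range (centerAction ρ𝔤))) := h.out
  set y : Algebra.adjoin ℂ (Set.range (centerAction ρ𝔤)) := ⟨centerAction ρ𝔤 z, Algebra.subset_adjoin ⟨z, rfl⟩⟩ with hy
  refine ⟨minpoly ℂ y, minpoly.ne_zero (Algebra.IsIntegral.isIntegral y), ?_⟩
  have h1 := congr_arg (Algebra.adjoin ℂ (Set.range (centerAction ρ𝔤))).val (minpoly.aeval ℂ y)
  rw [← aeval_algHom_apply, map_zero] at h1
  exact h1

/-- Under an infinitesimal character `θ`, `z` acts by the scalar `θ(z)` (unfolding of `HasInfinitesimalCharacter` through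
`centerAction`). [cite: KnappVogan1995, §VII.2 (7.13) Example 1] -/
theorem _root_.Literature.NumberTheory.Automorphic.HasInfinitesimalCharacter.centerAction_eq_smul_one
    {θ : centerU G →ₐ[ℝ] ℂ} (h : HasInfinitesimalCharacter ρ𝔤 θ) (z : centerU G) : centerAction ρ𝔤 z = θ z • 1 := by
  rw [centerAction_apply, h z, Algebra.algebraMap_eq_smul_one]

/-- `P_θ(V)` lies in the generalized eigenspace of each single `z ∈ Z(𝔤)` for `θ(z)`. [cite: KnappVogan1995, §VII.2 (before Prop. 7.20)] -/
theorem _root_.Literature.NumberTheory.Automorphic.primaryComponent_le_maxGenEigenspace (θ : centerU G →ₐ[ℝ] ℂ)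
    (z : centerU G) :
    primaryComponent ρ𝔤 θ ≤ (centerAction ρ𝔤 z).maxGenEigenspace (θ z) :=
  iInf_le (fun z : centerU G => (centerAction ρ𝔤 z).maxGenEigenspace (θ z)) z

/-- **A non-zero `V` has at most one generalized infinitesimal character** (the primary components of distinct characters are
independent, (7.25)). [cite: KnappVogan1995, §VII.2 Prop. 7.20 (7.25)] -/
theorem _root_.Literature.NumberTheory.Automorphic.HasGenInfinitesimalCharacter.unique [Nontrivial V]
    {θ θ' : centerU G →ₐ[ℝ] ℂ} (h : HasGenInfinitesimalCharacter ρ𝔤 θ) (h' : HasGenInfinitesimalCharacter ρ𝔤 θ') : θ = θ' := by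
  by_contra hne
  have hdis := (iSupIndep_primaryComponent ρ𝔤).pairwiseDisjoint hne
  rw [Function.onFun, h.primaryComponent_eq_top, h'.primaryComponent_eq_top, disjoint_self] at hdis
  exact top_ne_bot hdis

end AnyGroup

/-! ## §2 `U(α, β)`: the Casimir ELEMENT `c ∈ Z(𝔤)` acts by the Casimir operator `C_V` -/

section Upq

variable {α β : Type*} [Fintype α] [DecidableEq α] [Fintype β] [DecidableEq β]

variable (α β) in
/-- **The Casimir element `c = Σ_s y_s y'_s ∈ Z(𝔤)`, `𝔤 = 𝔲(α, β)`**, for the trace form `B` and its adapted basis `(y_s)` with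
`B`-dual basis `(y'_s)` (the tree's `casimirElement`, central by `casimirElement_mem_center`: «`C` … lies in the center of
`U(𝔤)`»). [cite: BorelWallach2000, II §1.3 (1)] [cite: KnappVogan1995, §IV.9 (4.109)] -/
def upqCasimirCenter : centerU (uFormGroup α β) :=
  ⟨casimirElement (upqTraceForm α β) upqTraceForm_nondegenerate (upqBasis α β),
    casimirElement_mem_center upqTraceForm_isSymm upqTraceForm_lieInvariant _⟩

/-- `c = Σ_s ι(y_s) ι(y'_s)` with the families `upqY`, `upqY'` of `UpqCasimirTensor`. [cite: BorelWallach2000, II §1.3 (1)] -/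
theorem coe_upqCasimirCenter :
    (upqCasimirCenter α β : UniversalEnvelopingAlgebra ℝ (uFormGroup α β).lie) = ∑ t, ι ℝ (upqY α β t) * ι ℝ (upqY' α β t) := by
  change casimirElement (upqTraceForm α β) upqTraceForm_nondegenerate (upqBasis α β) = _
  rw [casimirElement]
  refine Finset.sum_congr rfl fun t _ => ?_
  rw [coe_upqBasis, ← upqDualBasis, coe_upqDualBasis]
  rfl

variable {V : Type*} [AddCommGroup V] [Module ℂ V] (ρ𝔤 : (uFormGroup α β).lie →ₗ⁅ℝ⁆ Module.End ℂ V)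

/-- **`c` acts on `(𝔤, K)`-module data by the Casimir operator: `ρ(c) = C_V = Σ_s ρ𝔤(y_s) ρ𝔤(y'_s)`.**
[cite: BorelWallach2000, II §1.3 (1)] [cite: KnappVogan1995, §VII.2 (7.13)] -/
theorem centerAction_upqCasimirCenter : centerAction ρ𝔤 (upqCasimirCenter α β) = upqCasimirOp ρ𝔤 := by
  rw [centerAction_apply, coe_upqCasimirCenter, map_sum]
  simp only [map_mul, envelopingAction_ι]
  rfl

/-- **Under an infinitesimal character `θ`, `C_V = θ(c)`.** [cite: KnappVogan1995, §VII.2 (7.13) Example 1] -/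
theorem upqCasimirOp_eq_smul_one_of_hasInfinitesimalCharacter {θ : centerU (uFormGroup α β) →ₐ[ℝ] ℂ}
    (h : HasInfinitesimalCharacter ρ𝔤 θ) : upqCasimirOp ρ𝔤 = θ (upqCasimirCenter α β) • 1 := by
  rw [← centerAction_upqCasimirCenter, h.centerAction_eq_smul_one ρ𝔤]

/-- **On `Z(𝔤)` finite data of `U(α, β)` the Casimir operator is algebraic.** [cite: KnappVogan1995, §VII.2 (7.13)] -/
theorem exists_aeval_upqCasimirOp_eq_zero_of_isCenterFinite (h : IsCenterFinite ρ𝔤) :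
    ∃ p : ℂ[X], p ≠ 0 ∧ aeval (upqCasimirOp ρ𝔤) p = 0 := by
  rw [← centerAction_upqCasimirCenter]
  exact h.exists_aeval_centerAction_eq_zero ρ𝔤 _

/-- **Under a generalized infinitesimal character `θ`, `(C_V − θ(c))ⁿ = 0`.** [cite: KnappVogan1995, §VII.2 (7.26a)] -/
theorem exists_pow_upqCasimirOp_sub_eq_zero_of_hasGenInfinitesimalCharacter
    {θ : centerU (uFormGroup α β) →ₐ[ℝ] ℂ} (h : HasGenInfinitesimalCharacter ρ𝔤 θ) :
    ∃ n : ℕ, ∀ v : V, ((upqCasimirOp ρ𝔤 - θ (upqCasimirCenter α β) • 1) ^ n) v = 0 := by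
  obtain ⟨n, hn⟩ := h.out
  exact ⟨n, fun v => by rw [← centerAction_upqCasimirCenter]; exact hn _ v⟩

/-- `P_θ(V) ⊆` the generalized eigenspace of `C_V` for `θ(c)`. [cite: KnappVogan1995, §VII.2 (before Prop. 7.20)] -/
theorem primaryComponent_le_maxGenEigenspace_upqCasimirOp (θ : centerU (uFormGroup α β) →ₐ[ℝ] ℂ) :
    primaryComponent ρ𝔤 θ ≤ (upqCasimirOp ρ𝔤).maxGenEigenspace (θ (upqCasimirCenter α β)) := by
  rw [← centerAction_upqCasimirCenter]
  exact primaryComponent_le_maxGenEigenspace ρ𝔤 θ _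

end Upq

/-! ## §3 `U(1,1)`: the centre element `Z = i·1 ∈ 𝔤 ⊆ Z(𝔤)`; `Z(𝔤)`-notions ⟹ `(Z, C)`-notions -/

section U11

/-- **The central element `Z = i·1` of `𝔤 = 𝔲(1,1)` as an element of `Z(𝔤)`** (`ι(Z)` commutes with `ι(𝔤)` since `[Z, 𝔤] = 0`).
[cite: KnappVogan1995, §VII.2 (7.13)] [cite: Bump1997, §2.2 (2.21)] -/
def u11ZCenter : centerU G11 :=
  ⟨ι ℝ U11FinRep.zCenter, Literature.Algebra.Lie.mem_center_of_forall_ι_comm fun X => by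
    have h := (ι ℝ : G11.lie →ₗ⁅ℝ⁆ UniversalEnvelopingAlgebra ℝ G11.lie).map_lie U11FinRep.zCenter X
    rw [U11FinRep.lie_zCenter, map_zero, LieRing.of_associative_ring_bracket] at h
    exact (sub_eq_zero.mp h.symm).symm⟩

/-- Unfolding. [cite: KnappVogan1995, §VII.2 (7.13)] -/
theorem coe_u11ZCenter : (u11ZCenter : UniversalEnvelopingAlgebra ℝ G11.lie) = ι ℝ U11FinRep.zCenter := rfl

variable {V : Type*} [AddCommGroup V] [Module ℂ V] (σ𝔤 : G11.lie →ₗ⁅ℝ⁆ Module.End ℂ V)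

/-- **`Z ∈ Z(𝔤)` acts by `ρ𝔤(Z)`.** [cite: KnappVogan1995, §VII.2 (7.13)] -/
theorem centerAction_u11ZCenter : centerAction σ𝔤 u11ZCenter = σ𝔤 U11FinRep.zCenter := by
  rw [centerAction_apply, coe_u11ZCenter, envelopingAction_ι]

/-- **`Z(𝔤)` finite ⟹ `(Z, C)`-finite at `U(1,1)`** (the lineage's rendering `U11HC.IsZCFinite` of (7.13) through the two
generators follows from Knapp–Vogan's). [cite: KnappVogan1995, §VII.2 (7.13)] -/
theorem isZCFinite_of_isCenterFinite (h : IsCenterFinite σ𝔤) : U11HC.IsZCFinite σ𝔤 :=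
  ⟨exists_aeval_upqCasimirOp_eq_zero_of_isCenterFinite σ𝔤 h, by
    rw [← centerAction_u11ZCenter]
    exact h.exists_aeval_centerAction_eq_zero σ𝔤 _⟩

/-- **A generalized infinitesimal character `θ` of `Z(𝔤)` gives the generalized infinitesimal character `(θ(Z), θ(c))` of the
lineage** (`U11Primary.HasGenInfChar`). [cite: KnappVogan1995, §VII.2 (7.26a)] -/
theorem u11HasGenInfChar_of_hasGenInfinitesimalCharacter {θ : centerU G11 →ₐ[ℝ] ℂ}
    (h : HasGenInfinitesimalCharacter σ𝔤 θ) :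
    U11Primary.HasGenInfChar σ𝔤 (θ u11ZCenter) (θ (upqCasimirCenter (Fin 1) (Fin 1))) := by
  obtain ⟨n, hn⟩ := h.out
  refine ⟨⟨n, fun v => ⟨?_, ?_⟩⟩⟩
  · rw [← centerAction_u11ZCenter]; exact hn _ v
  · rw [← centerAction_upqCasimirCenter]; exact hn _ v

/-- **An infinitesimal character `θ` of `Z(𝔤)` gives `ρ𝔤(Z) = θ(Z)`, `C = θ(c)`** and hence the lineage's generalized infinitesimal
character `(θ(Z), θ(c))`. [cite: KnappVogan1995, §VII.2 (7.13) Example 1] -/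
theorem u11_scalars_of_hasInfinitesimalCharacter {θ : centerU G11 →ₐ[ℝ] ℂ} (h : HasInfinitesimalCharacter σ𝔤 θ) :
    (∀ v : V, σ𝔤 U11FinRep.zCenter v = θ u11ZCenter • v) ∧
      ∀ v : V, upqCasimirOp σ𝔤 v = θ (upqCasimirCenter (Fin 1) (Fin 1)) • v := by
  refine ⟨fun v => ?_, fun v => ?_⟩
  · rw [← centerAction_u11ZCenter, h.centerAction_eq_smul_one σ𝔤, LinearMap.smul_apply, Module.End.one_apply]
  · rw [upqCasimirOp_eq_smul_one_of_hasInfinitesimalCharacter σ𝔤 h, LinearMap.smul_apply, Module.End.one_apply]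

/-- **`P_θ(V) ⊆` the joint generalized eigenspace of `(ρ𝔤(Z), C)` for `(θ(Z), θ(c))`** — Knapp–Vogan's primary component refines
the lineage's. [cite: KnappVogan1995, §VII.2 (before Prop. 7.20)] -/
theorem primaryComponent_le_inf_maxGenEigenspace (θ : centerU G11 →ₐ[ℝ] ℂ) :
    primaryComponent σ𝔤 θ ≤ (σ𝔤 U11FinRep.zCenter).maxGenEigenspace (θ u11ZCenter) ⊓
      (upqCasimirOp σ𝔤).maxGenEigenspace (θ (upqCasimirCenter (Fin 1) (Fin 1))) := by
  refine le_inf ?_ (primaryComponent_le_maxGenEigenspace_upqCasimirOp σ𝔤 θ)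
  rw [← centerAction_u11ZCenter]
  exact primaryComponent_le_maxGenEigenspace σ𝔤 θ _

variable {M : Type*} [AddCommGroup M] [Module ℂ M] [Module (GKRing G11) M] [IsScalarTower ℂ (GKRing G11) M]
variable (hM : IsGKModule G11 (GKRing.actK G11 M) (GKRing.actLie G11 M))

/-- For a `(𝔤, K)`-module over the operator ring: **`P_θ(M) ⊆ P_{(θ(Z), θ(c))}(M)`** (`U11Primary.primary`).
[cite: KnappVogan1995, §VII.2 (before Prop. 7.20)] -/
theorem primaryComponent_le_primary (θ : centerU G11 →ₐ[ℝ] ℂ) :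
    primaryComponent (GKRing.actLie G11 M) θ ≤
      (U11Primary.primary hM (θ u11ZCenter) (θ (upqCasimirCenter (Fin 1) (Fin 1)))).restrictScalars ℂ := by
  rw [U11Primary.restrictScalars_primary]
  exact primaryComponent_le_inf_maxGenEigenspace _ θ

include hM in
/-- **Support of Knapp–Vogan's primary decomposition at `U(1,1)`: `P_θ(M) ≠ 0 ⟹ θ(Z) = i·s` for an integer `s`** (the
`K`-types are integral). [cite: KnappVogan1995, §VII.2 Prop. 7.20] [cite: Bump1997, Prop. 2.5.2] -/
theorem exists_int_of_primaryComponent_ne_bot {θ : centerU G11 →ₐ[ℝ] ℂ} (h : primaryComponent (GKRing.actLie G11 M) θ ≠ ⊥) :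
    ∃ s : ℤ, θ u11ZCenter = Complex.I * (s : ℂ) := by
  refine U11Primary.exists_int_of_primary_ne_bot hM (lam := θ (upqCasimirCenter (Fin 1) (Fin 1))) fun h0 => h ?_
  rw [eq_bot_iff]
  intro m hm
  have hm' := primaryComponent_le_primary hM θ hm
  rw [h0, Submodule.restrictScalars_bot] at hm'
  exact hm'

include hM in
/-- **… and then some `t` of the finite test set `testSet s θ(c)` is a `K`-type of `M`** (for `(Z, C)`-finite `M`; Cor. 7.27 +
Cor. 7.207's «at least one of `τ_{μ₁}, …, τ_{μ_n}` occurs»). [cite: KnappVogan1995, Cor. 7.27, Cor. 7.207] -/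
theorem exists_mem_testSet_of_primaryComponent_ne_bot (hZC : U11HC.IsZCFinite (GKRing.actLie G11 M))
    {θ : centerU G11 →ₐ[ℝ] ℂ} {s : ℤ} (hs : θ u11ZCenter = Complex.I * (s : ℂ))
    (h : primaryComponent (GKRing.actLie G11 M) θ ≠ ⊥) :
    ∃ t ∈ U11HC.testSet s (θ (upqCasimirCenter (Fin 1) (Fin 1))),
      U11Irred.wtSpace (GKRing.actK G11 M) t (s - t) ≠ ⊥ := by
  refine U11Primary.exists_mem_testSet_of_primary_ne_bot hM hZC fun h0 => h ?_
  rw [eq_bot_iff]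
  intro m hm
  have hm' := primaryComponent_le_primary hM θ hm
  rw [hs, h0, Submodule.restrictScalars_bot] at hm'
  exact hm'

end U11

end Literature.RepresentationTheory.BorelWallach2000
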